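import Summits.PneNP.PneNP.Theorems.SymmetryBudgetNoHiddenOrderBranchSumFrozen

/-!
# BranchSum VIII: a node whose cells are all pairs is the last one (CG84-FLATNESS.md §13.5, CTG3′)

On a refinement path (`BranchSum.RefinementPath`, H1–H5 of CG84-FLATNESS §9.3), if at node `k` every
cell has exactly two elements, then nothing survives the transition `k → k+1`:

* `W_succ_eq_empty_of_pairs` : `W (k+1) = ∅`.  Proof: some vertex is removed (H5); if something
  survived, connectivity of the switching graph (H3) gives a switching-edge at node `k` from a removed
  vertex `a` to a surviving vertex `b`; the node-`(k+1)` cell of `b` has at least two elements and lies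
  in its node-`k` cell `{b, b'}`, so it IS that pair — contradicting `cell_ne_of_swAdj_of_removed`
  (F2/G1: a switching-neighbour cell of a removed vertex splits).
* `eq_N_of_pairs` : hence `k + 1 = N` whenever `k < N` — such a node is the last of the path, and the
  branch sum after it is `0`.

This is the formal kernel of the tight case of the cost-to-go law CTG3′ of the memo
(`C ≤ M + a − 2c`, equality on all-pairs states): after entering one pair, an all-pairs state of the
Corneil–Goldberg process dissolves completely.
-/

namespace Summit.PneNP.PneNP.Theorems

open Finset

namespace BranchSum

variable {V : Type*} [DecidableEq V] {G : SimpleGraph V} [DecidableRel G.Adj] {N : ℕ}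

namespace RefinementPath

variable (R : RefinementPath G N)

/-- **Pairs collapse.** If every node-`k` cell has exactly two elements (`k < N`), then `W (k+1) = ∅`. -/
theorem W_succ_eq_empty_of_pairs {k : ℕ} (hk : k < N) (hpairs : ∀ u ∈ R.W k, (R.cell k u).card = 2) :
    R.W (k + 1) = ∅ := by
  by_contra hne
  have hne' : (R.W (k + 1)).Nonempty := nonempty_iff_ne_empty.2 hne
  -- the removed set `S = W k \ W (k+1)` is nonempty (H5) and proper
  obtain ⟨x, hx, hx'⟩ := R.exists_removed hk
  set S := R.W k \ R.W (k + 1) with hS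
  have hSsub : S ⊆ R.W k := sdiff_subset
  have hSne : S.Nonempty := ⟨x, mem_sdiff.2 ⟨hx, hx'⟩⟩
  have hSneW : S ≠ R.W k := by
    intro h
    obtain ⟨b, hb⟩ := hne'
    have : b ∈ S := h.symm ▸ R.nest k hb
    exact (mem_sdiff.1 this).2 hb
  obtain ⟨a, ha, b, hb, hab⟩ := R.connected k S hSsub hSne hSneW
  rw [mem_sdiff] at hb
  have hbW : b ∈ R.W (k + 1) := by
    by_contra h; exact hb.2 (mem_sdiff.2 ⟨hb.1, h⟩)
  have haW : a ∈ R.W k := hSsub ha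
  have haW' : a ∉ R.W (k + 1) := (mem_sdiff.1 ha).2
  -- the node-(k+1) cell of `b` is its node-`k` pair
  have hsub : R.cell (k + 1) b ⊆ R.cell k b := R.cell_subset_cell_of_le (Nat.le_succ k) hbW
  have hcard : (R.cell k b).card ≤ (R.cell (k + 1) b).card := by
    rw [hpairs b hb.1]; exact R.two_le (k + 1) b hbW
  have heq : R.cell (k + 1) b = R.cell k b := eq_of_subset_of_card_le hsub hcard
  exact R.cell_ne_of_swAdj_of_removed (Nat.lt_succ_self k) haW haW' hbW hab heq

/-- An all-pairs node is the last node of the path. -/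
theorem eq_N_of_pairs {k : ℕ} (hk : k < N) (hpairs : ∀ u ∈ R.W k, (R.cell k u).card = 2) :
    k + 1 = N := by
  have hempty := R.W_succ_eq_empty_of_pairs hk hpairs
  by_contra hne
  have hlt : k + 1 < N := lt_of_le_of_ne (Nat.succ_le_of_lt hk) hne
  obtain ⟨x, hx, -⟩ := R.exists_removed hlt
  rw [hempty] at hx
  exact notMem_empty x hx

end RefinementPath

end BranchSum

end Summit.PneNP.PneNP.Theorems
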